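import Literature.Geometry.Symplectic.SteinDomainDiffeomorph
import Literature.Geometry.Symplectic.SteinLiouville
import HarnessLib

/-!
# The Levi form is natural under `J`-holomorphic maps

Topic `Literature/Geometry/Symplectic`; proofs file of the fact seat of
`Literature.Geometry.Symplectic.Gompf1998_thm13_twoHandles` (**E2**, `SteinTwoHandles.lean`).
Eliashberg's holomorphic gluing (Gompf 1998, p. 6: *"Each 2-handle is given as a neighborhood
of `D² × 0 ⊂ iℝ² × ℝ² = ℂ²` … glued to the given Legendrian curve"*) transfers the `J`-convex
function of the Stein domain to the flat model through a holomorphic map, and plurisubharmonic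
functions pull back to plurisubharmonic functions under holomorphic maps (Fritzsche–Grauert,
Ch. II, Cor. 2.9: *"Let `F : G₁ → G₂` be a holomorphic map, and `g` plurisubharmonic. Then
`g ∘ F` is plurisubharmonic"*).  This file proves the underlying identity for the tree's
`d^ℂφ = dφ ∘ J` and Levi form `-dd^ℂφ_x(v, J_x v)` (`SteinDomain.lean`) and a map
`f : P → M` between two `4`-manifolds with boundary carrying fields of endomorphisms `J_P`,
`J_M` which is **`J`-holomorphic** near a point, `df ∘ J_P = J_M ∘ df` (no invertibility of
`df` is needed for the identity; `SteinDomainDiffeomorph.lean` is the case of a diffeomorphism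
with `J_P` *defined* as the pull-back):

* `dComplex_comp_eq_pullback_of_holomorphicAt` — `d^ℂ_{J_P}(φ ∘ f)_x = f^*(d^ℂ_{J_M} φ)_x`
  at a point where `df_x ∘ J_P = J_M ∘ df_x` (chain rule);
* `levi_comp_of_holomorphic` — **`-dd^ℂ(φ ∘ f)_x(v, J_P v) = -dd^ℂφ_{f x}(df_x v, J_M df_x v)`**
  for `f` smooth and `J`-holomorphic near `x`, `φ` smooth, `J_M` preserving smooth vector
  fields (locality and naturality of `d`, `mextDeriv_congr_of_eventuallyEq`,
  `mextDeriv_pullback_apply_of_differentiableWithinAt`);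
* `levi_comp_pos_of_holomorphic` — hence **strict `J`-convexity pulls back along
  `J`-holomorphic immersions**: if `df_x` is injective and `φ` is strictly `J_M`-convex at
  `f x`, then `φ ∘ f` is strictly `J_P`-convex at `x` (Fritzsche–Grauert, loc. cit.;
  Cieliebak–Eliashberg 2012, §2.2).

Everything is **proved**; no definition, no named fact.

## References

* K. Fritzsche, H. Grauert, *From Holomorphic Functions to Complex Manifolds*, GTM 213,
  Springer (2002), Ch. II, §2, Example 4 and Cor. 2.9. [FritzscheGrauert2002]
* K. Cieliebak, Ya. Eliashberg, *From Stein to Weinstein and Back*, AMS Colloquium Publ. 59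
  (2012), §2.2 (`J`-convex functions; naturality under holomorphic maps). [CieliebakEliashberg2012]
* R. E. Gompf, *Handlebody construction of Stein surfaces*, Ann. of Math. 148 (1998), p. 622
  (the holomorphic gluing of the standard handle). [Gompf1998]
-/

noncomputable section

open scoped Manifold ContDiff Topology
open Set Function Filter

namespace Literature.Geometry.Symplectic

open Literature.Geometry.Kaehler

variable {P M : Type*} [TopologicalSpace P] [ChartedSpace (EuclideanHalfSpace 4) P]
  [IsManifold (𝓡∂ 4) ∞ P] [TopologicalSpace M] [ChartedSpace (EuclideanHalfSpace 4) M]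
  [IsManifold (𝓡∂ 4) ∞ M]
  {JP : (x : P) → (EuclideanSpace ℝ (Fin 4) →L[ℝ] EuclideanSpace ℝ (Fin 4))}
  {JM : (y : M) → (EuclideanSpace ℝ (Fin 4) →L[ℝ] EuclideanSpace ℝ (Fin 4))}
  {f : P → M} {φ : M → ℝ}

omit [IsManifold (𝓡∂ 4) ∞ P] [IsManifold (𝓡∂ 4) ∞ M] in
/-- **`d^ℂ(φ ∘ f) = f^*(d^ℂφ)` at a point of holomorphy.**  If `φ` is differentiable at `f x`,
`f` at `x`, and `df_x ∘ J_P(x) = J_M(f x) ∘ df_x`, then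
`d^ℂ_{J_P}(φ ∘ f)_x = f^*(d^ℂ_{J_M} φ)_x`:
`d(φ ∘ f)_x (J_P v) = dφ_{f x}(df_x J_P v) = dφ_{f x}(J_M df_x v)`.
[cite: FritzscheGrauert2002, Ch. II Cor. 2.9] -/
theorem dComplex_comp_eq_pullback_of_holomorphicAt {x : P}
    (hφ : MDifferentiableAt (𝓡∂ 4) 𝓘(ℝ, ℝ) φ (f x)) (hf : MDifferentiableAt (𝓡∂ 4) (𝓡∂ 4) f x)
    (hhol : ∀ v : EuclideanSpace ℝ (Fin 4),
      mfderiv (𝓡∂ 4) (𝓡∂ 4) f x (JP x v) = JM (f x) (mfderiv (𝓡∂ 4) (𝓡∂ 4) f x v)) :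
    dComplex JP (φ ∘ f) x = (dComplex JM φ).pullback (𝓡∂ 4) f x := by
  ext v
  rw [dComplex_apply, MForm.pullback_apply, dComplex_apply, mfderiv_comp x hφ hf]
  show mfderiv (𝓡∂ 4) 𝓘(ℝ, ℝ) φ (f x) (mfderiv (𝓡∂ 4) (𝓡∂ 4) f x (JP x (v 0))) =
    mfderiv (𝓡∂ 4) 𝓘(ℝ, ℝ) φ (f x) (JM (f x) (mfderiv (𝓡∂ 4) (𝓡∂ 4) f x (v 0)))
  rw [hhol]

/-- **Naturality of the Levi form under `J`-holomorphic maps.**  Let `f : P → M` be `C^∞` near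
`x` with `df ∘ J_P = J_M ∘ df` near `x`, `φ : M → ℝ` smooth and `J_M` preserving smooth vector
fields (so that `d^ℂφ` is a smooth `1`-form).  Then for every `v`,
`-dd^ℂ(φ ∘ f)_x(v, J_P(x) v) = -dd^ℂφ_{f x}(df_x v, J_M(f x) df_x v)`:
`d^ℂ(φ ∘ f) = f^*(d^ℂφ)` near `x` (previous lemma), `d` is local and commutes with pull-backs
(`mextDeriv_pullback_apply_of_differentiableWithinAt`), and `df_x(J_P v) = J_M(df_x v)`.
[cite: FritzscheGrauert2002, Ch. II Cor. 2.9] [cite: CieliebakEliashberg2012, §2.2] -/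
theorem levi_comp_of_holomorphic [T2Space M] (hJM : PreservesSmoothFields JM)
    (hφ : ContMDiff (𝓡∂ 4) 𝓘(ℝ, ℝ) ∞ φ) {x : P} (hf : ∀ᶠ z in 𝓝 x, ContMDiffAt (𝓡∂ 4) (𝓡∂ 4) ∞ f z)
    (hhol : ∀ᶠ z in 𝓝 x, ∀ v : EuclideanSpace ℝ (Fin 4),
      mfderiv (𝓡∂ 4) (𝓡∂ 4) f z (JP z v) = JM (f z) (mfderiv (𝓡∂ 4) (𝓡∂ 4) f z v))
    (v : EuclideanSpace ℝ (Fin 4)) :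
    -(mextDeriv (dComplex JP (φ ∘ f)) x ![v, JP x v]) =
      -(mextDeriv (dComplex JM φ) (f x)
        ![mfderiv (𝓡∂ 4) (𝓡∂ 4) f x v, JM (f x) (mfderiv (𝓡∂ 4) (𝓡∂ 4) f x v)]) := by
  have hφd : MDifferentiable (𝓡∂ 4) 𝓘(ℝ, ℝ) φ := hφ.mdifferentiable (by simp)
  -- `d^ℂ(φ ∘ f) = f^*(d^ℂφ)` near `x`
  have heq : ∀ᶠ z in 𝓝 x, dComplex JP (φ ∘ f) z = (dComplex JM φ).pullback (𝓡∂ 4) f z := by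
    filter_upwards [hf, hhol] with z hz hz'
    exact dComplex_comp_eq_pullback_of_holomorphicAt (hφd (f z)) (hz.mdifferentiableAt (by simp)) hz'
  -- `d^ℂφ` is differentiable in its chart at `f x`
  have hdiff : DifferentiableWithinAt ℝ ((dComplex JM φ).inChart (f x)) (range (𝓡∂ 4))
      (extChartAt (𝓡∂ 4) (f x) (f x)) :=
    ((isSmoothForm_dComplex_of_preservesSmoothFields hJM hφ) (f x)).differentiableWithinAt (by simp)
  -- the vectors
  have hv : (fun i => mfderiv (𝓡∂ 4) (𝓡∂ 4) f x (![v, JP x v] i)) =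
      ![mfderiv (𝓡∂ 4) (𝓡∂ 4) f x v, JM (f x) (mfderiv (𝓡∂ 4) (𝓡∂ 4) f x v)] := by
    funext i
    fin_cases i
    · rfl
    · exact hhol.self_of_nhds v
  rw [mextDeriv_congr_of_eventuallyEq heq, mextDeriv_pullback_apply_of_differentiableWithinAt hf hdiff,
    MForm.pullback_apply]
  exact congrArg (fun w : Fin 2 → EuclideanSpace ℝ (Fin 4) => -(mextDeriv (dComplex JM φ) (f x) w)) hv

/-- **Strict `J`-convexity pulls back along `J`-holomorphic immersions** (Fritzsche–Grauert,
Ch. II, Cor. 2.9; Cieliebak–Eliashberg 2012, §2.2): under the hypotheses of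
`levi_comp_of_holomorphic`, if `df_x` is injective and `φ` is strictly `J_M`-convex at `f x`,
then `φ ∘ f` is strictly `J_P`-convex at `x`. [cite: FritzscheGrauert2002, Ch. II Cor. 2.9] -/
theorem levi_comp_pos_of_holomorphic [T2Space M] (hJM : PreservesSmoothFields JM)
    (hφ : ContMDiff (𝓡∂ 4) 𝓘(ℝ, ℝ) ∞ φ) {x : P} (hf : ∀ᶠ z in 𝓝 x, ContMDiffAt (𝓡∂ 4) (𝓡∂ 4) ∞ f z)
    (hhol : ∀ᶠ z in 𝓝 x, ∀ v : EuclideanSpace ℝ (Fin 4),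
      mfderiv (𝓡∂ 4) (𝓡∂ 4) f z (JP z v) = JM (f z) (mfderiv (𝓡∂ 4) (𝓡∂ 4) f z v))
    (hinj : Injective (mfderiv (𝓡∂ 4) (𝓡∂ 4) f x))
    (hconv : ∀ w : EuclideanSpace ℝ (Fin 4), w ≠ 0 →
      0 < -(mextDeriv (dComplex JM φ) (f x) ![w, JM (f x) w]))
    {v : EuclideanSpace ℝ (Fin 4)} (hv : v ≠ 0) :
    0 < -(mextDeriv (dComplex JP (φ ∘ f)) x ![v, JP x v]) := by
  rw [levi_comp_of_holomorphic hJM hφ hf hhol v]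
  refine hconv _ fun h0 => hv (hinj ?_)
  exact h0.trans (map_zero (mfderiv (𝓡∂ 4) (𝓡∂ 4) f x)).symm

/-- **Global form.**  If `f : P → M` is smooth and `J`-holomorphic everywhere
(`df ∘ J_P = J_M ∘ df`) with injective differentials, `J_M` preserves smooth vector fields and
`φ` is a smooth strictly `J_M`-convex function on `M`, then `φ ∘ f` is strictly `J_P`-convex on
`P`. [cite: FritzscheGrauert2002, Ch. II Cor. 2.9] -/
theorem levi_comp_pos_of_holomorphic_global [T2Space M] (hJM : PreservesSmoothFields JM)
    (hφ : ContMDiff (𝓡∂ 4) 𝓘(ℝ, ℝ) ∞ φ) (hf : ContMDiff (𝓡∂ 4) (𝓡∂ 4) ∞ f)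
    (hhol : ∀ z, ∀ v : EuclideanSpace ℝ (Fin 4),
      mfderiv (𝓡∂ 4) (𝓡∂ 4) f z (JP z v) = JM (f z) (mfderiv (𝓡∂ 4) (𝓡∂ 4) f z v))
    (hinj : ∀ x, Injective (mfderiv (𝓡∂ 4) (𝓡∂ 4) f x))
    (hconv : ∀ y, ∀ w : EuclideanSpace ℝ (Fin 4), w ≠ 0 →
      0 < -(mextDeriv (dComplex JM φ) y ![w, JM y w]))
    (x : P) {v : EuclideanSpace ℝ (Fin 4)} (hv : v ≠ 0) :
    0 < -(mextDeriv (dComplex JP (φ ∘ f)) x ![v, JP x v]) :=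
  levi_comp_pos_of_holomorphic hJM hφ (Eventually.of_forall fun z => hf z)
    (Eventually.of_forall hhol) (hinj x) (hconv (f x)) hv

end Literature.Geometry.Symplectic

end
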